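import Summits.AtomisticToContinuum.HydrodynamicLimit.Theses.JParityClosure

/-!
# Negative knowledge for crux `JParityClosure.OddContactSymmetry` (stmt-AtomisticToContinuum-13078):
# the truncated reweighting is NOT parity-exact — the truncation window

From the route refuter `refuter-drefute-stmt-AtomisticToContinuum-13078-0` (drefute pass on the line
`equilibrium-rung-mean-variance`, 2026-08-16; companion notes `Cruxes/OddContactSymmetry/DrefuteS2S6Survival.md` §S3 and
`DrefuteStubReweightingTight.md`).  Dynamics-free, sorry-free algebra complementing
`OddContactSymmetryNegative.reweighted_odd_residual` (the UNtruncated weight `1 + b′/b` is `J`-symmetric iff `ab′ = a′b`, in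
particular identically when the estimator is perfect, `b = a`, `b′ = a′`).

Dictionary.  `a > 0` = incoming contact pair density at `q = (n̂, v, w)`, `a′ > 0` = at the inverse collision `J q = (−n̂, v′, w′)`;
with a PERFECT estimator (mollified law = true law, pre-collisional chaos) the crux's reweighting factor is `1 + a′/a` at `q` and
`1 + a/a′` at `J q`.  The line `equilibrium-rung-mean-variance` (stubs S2–S4) and the proposed repair C′₂ of the crux TRUNCATE it:
`min (1 + a′/a) L`.  Against every `J`-odd mark the truncated statistic then integrates the odd residual
`a · min(1 + a′/a, L) − a′ · min(1 + a/a′, L) = min(a + a′, L a) − min(a + a′, L a′)` (`truncResidual_eq`), and: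

* `truncResidual_eq_zero_iff` (`L ≥ 2`): the residual vanishes iff the density ratio lies in the TRUNCATION WINDOW,
  `a ≤ (L−1) a′ ∧ a′ ≤ (L−1) a`, i.e. `a′/a ∈ [1/(L−1), L−1]`; outside it the residual is `(L−1)a − a′ < 0`
  (`truncResidual_of_lt_right`) resp. `a − (L−1)a′ > 0` (`truncResidual_of_lt_left`).
* `truncResidual_eq_zero_iff_of_lt_two` (`0 < L < 2`): the residual vanishes iff `a = a′`.

Consequence recorded for the planner (not a refutation of any filed statement): the UNtruncated weight symmetrises the odd statistic
for EVERY one-body law (that was its design), the truncated one only inside the window — at `L ≤ 2` the vanishing of the truncated /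
unweighted J-odd contact statistic for all odd marks is EQUIVALENT to `a = a′` on the collision manifold, i.e. (with chaos) to
`f(v)f(w) = f(v′)f(w′)`, local Maxwellianity; at `L > 2` to `|log(a′/a)| ≤ log(L−1)`.  So a crux re-filed with the truncated weight
(C′₂, `∀ L ≥ 1`) carries local velocity equilibration in its limit content, whereas energy-shell-supported marks (C′₁) keep the exact
symmetrisation.  `not_truncation_parity_exact` is the refuted natural strengthening "truncation changes the weight but not the
parity content" (witness `a = 1, a′ = 3, L = 2`).
-/

noncomputable section

namespace Summit.AtomisticToContinuum.HydrodynamicLimit.Theorems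

namespace OddContactSymmetryNegative

/-- **The truncated odd residual, cleared of denominators.**  For positive pair densities,
`a·min(1 + a′/a, L) − a′·min(1 + a/a′, L) = min(a + a′, La) − min(a + a′, La′)`. [folklore] -/
theorem truncResidual_eq (a a' L : ℝ) (ha : 0 < a) (ha' : 0 < a') :
    a * min (1 + a' / a) L - a' * min (1 + a / a') L = min (a + a') (L * a) - min (a + a') (L * a') := by
  have h1 : a * min (1 + a' / a) L = min (a + a') (L * a) := by
    rw [mul_min_of_nonneg _ _ ha.le]
    congr 1
    · field_simp
    · ring
  have h2 : a' * min (1 + a / a') L = min (a + a') (L * a') := by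
    rw [mul_min_of_nonneg _ _ ha'.le]
    congr 1
    · field_simp
      ring
    · ring
  rw [h1, h2]

/-- **Inside the truncation window the residual vanishes** (no hypothesis on `L` needed: the window is empty for `L < 2`
unless `a = a′ = 0`). [folklore] -/
theorem truncResidual_eq_zero_of_window (a a' L : ℝ) (h₁ : a ≤ (L - 1) * a') (h₂ : a' ≤ (L - 1) * a) :
    min (a + a') (L * a) - min (a + a') (L * a') = 0 := by
  rw [min_eq_left (by linarith), min_eq_left (by linarith), sub_self]

/-- **Right of the window** (`a′ > (L−1)a`, `L ≥ 2`): the residual is `(L−1)a − a′ < 0`. [folklore] -/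
theorem truncResidual_of_lt_right (a a' L : ℝ) (ha : 0 ≤ a) (hL : 2 ≤ L) (h : (L - 1) * a < a') :
    min (a + a') (L * a) - min (a + a') (L * a') = (L - 1) * a - a' := by
  have hLa : L * a ≤ a + a' := by linarith
  have hL1 : 0 ≤ L - 1 := by linarith
  have h0 : 0 ≤ (L - 1) * a := mul_nonneg hL1 ha
  have ha' : 0 ≤ a' := h0.trans h.le
  have s1 : a ≤ (L - 1) * a := by nlinarith
  have s2 : a' ≤ (L - 1) * a' := by nlinarith
  have hwin : a + a' ≤ L * a' := by linarith
  rw [min_eq_right hLa, min_eq_left hwin]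
  ring

/-- **Left of the window** (`a > (L−1)a′`, `L ≥ 2`): the residual is `a − (L−1)a′ > 0`. [folklore] -/
theorem truncResidual_of_lt_left (a a' L : ℝ) (ha' : 0 ≤ a') (hL : 2 ≤ L) (h : (L - 1) * a' < a) :
    min (a + a') (L * a) - min (a + a') (L * a') = a - (L - 1) * a' := by
  have hLa' : L * a' ≤ a + a' := by linarith
  have hL1 : 0 ≤ L - 1 := by linarith
  have h0 : 0 ≤ (L - 1) * a' := mul_nonneg hL1 ha'
  have ha : 0 ≤ a := h0.trans h.le
  have s1 : a' ≤ (L - 1) * a' := by nlinarith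
  have s2 : a ≤ (L - 1) * a := by nlinarith
  have hwin : a + a' ≤ L * a := by linarith
  rw [min_eq_left hwin, min_eq_right hLa']
  ring

/-- **The truncation window is the exact parity content for `L ≥ 2`.**  For positive densities the truncated odd residual
vanishes iff `a′/a ∈ [1/(L−1), L−1]`. [folklore] -/
theorem truncResidual_eq_zero_iff (a a' L : ℝ) (ha : 0 < a) (ha' : 0 < a') (hL : 2 ≤ L) :
    a * min (1 + a' / a) L - a' * min (1 + a / a') L = 0 ↔ a ≤ (L - 1) * a' ∧ a' ≤ (L - 1) * a := by
  rw [truncResidual_eq a a' L ha ha']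
  constructor
  · intro h0
    by_contra hne
    rcases not_and_or.mp hne with h₁ | h₂
    · have hlt : (L - 1) * a' < a := lt_of_not_ge h₁
      rw [truncResidual_of_lt_left a a' L ha'.le hL hlt] at h0
      linarith
    · have hlt : (L - 1) * a < a' := lt_of_not_ge h₂
      rw [truncResidual_of_lt_right a a' L ha.le hL hlt] at h0
      linarith
  · rintro ⟨h₁, h₂⟩
    exact truncResidual_eq_zero_of_window a a' L h₁ h₂

/-- **Below `L = 2` truncation forces detailed balance itself.**  For `0 < L < 2` and positive densities the truncated odd
residual vanishes iff `a = a′` (with chaos: `f f_* = f′f′_*` on the collision manifold, i.e. a local Maxwellian). [folklore] -/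
theorem truncResidual_eq_zero_iff_of_lt_two (a a' L : ℝ) (ha : 0 < a) (ha' : 0 < a') (hL0 : 0 < L) (hL : L < 2) :
    a * min (1 + a' / a) L - a' * min (1 + a / a') L = 0 ↔ a = a' := by
  rw [truncResidual_eq a a' L ha ha']
  constructor
  · intro h0
    by_contra hne
    rcases lt_or_gt_of_ne hne with hlt | hgt
    · have hA : min (a + a') (L * a) ≤ L * a := min_le_right _ _
      have hB : L * a < min (a + a') (L * a') := by
        apply lt_min
        · nlinarith
        · nlinarith
      linarith
    · have hA : min (a + a') (L * a') ≤ L * a' := min_le_right _ _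
      have hB : L * a' < min (a + a') (L * a) := by
        apply lt_min
        · nlinarith
        · nlinarith
      linarith
  · rintro rfl
    exact sub_self _

/-- **Refuted natural strengthening: "truncation changes the weight but not the parity content".**  It is false that the
truncated reweighting is `J`-symmetric for all positive densities and all `L ≥ 2`: `a = 1, a′ = 3, L = 2` gives
`1·min(4,2) − 3·min(4/3,2) = −2`. [folklore] -/
theorem not_truncation_parity_exact :
    ¬ ∀ a a' L : ℝ, 0 < a → 0 < a' → 2 ≤ L → a * min (1 + a' / a) L - a' * min (1 + a / a') L = 0 := by
  intro h
  have h0 := h 1 3 2 one_pos (by norm_num) le_rfl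
  have : (1 : ℝ) * min (1 + 3 / 1) 2 - 3 * min (1 + 1 / 3) 2 = -2 := by norm_num
  linarith

end OddContactSymmetryNegative

end Summit.AtomisticToContinuum.HydrodynamicLimit.Theorems

end
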